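import Summits.ResolutionOfSingularities.ResolutionOfSingularities.Theorems.FrobeniusClosingPatchingRelPerfectMonomialGameMoveMarked
import Summits.ResolutionOfSingularities.ResolutionOfSingularities.Theorems.FrobeniusClosingPatchingRelPerfectMonomialSumStratumStep
import HarnessLib

/-!
# Crux `PatchingRelPerfect` (stmt-ResolutionOfSingularities-16161), chain W5.2 — F7(β) (β-AX) X3 C-I finish, CE1
# `…DepthPhaseCCarrierGameLift`, part 1 (WIN READ-OUTS): a marking-one win of the carrier game is the unit ideal, and an
# ideal that is trivial on a carrier it contains is trivial

[OURS · L1 W5.2 · res-L1-w52-plan-1 NOTE G11-40 (3) / G11-49 (1)–(2) → res-D-pv-046 g9; signature scratch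
`D/res-D-pv-046/DepthPhaseCCarrierGameLift.scratch.lean` (D1)–(D2)] Replaces the role of NO printed item; fact-free.

CE1 runs the MARKING-1 polyhedra game (`PolyhedraGame.WinnableAll 1`, won by `PolyhedraGame.routeKTarget le_rfl`) on the trace
`J = K|_Γ` of the Phase-C ideal `K` on its carrier `Γ = V(G)`, `G ≤ K`, through the scheme dictionary `MonomialCleanup.GameInv`
(moves: `gameInv_move_of_permissibleM`, …MonomialGameMoveMarked; transform law: `DepthMultiHost.controlledTransform_monomialSum_stratum`,
…DepthMultiHostEnd), and lifts the sequence to `X` by Kollár's push-forward (`CentreSeq.pushforward`, `KollarPushforward.lean`;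
`CentreSeq.transformMarked_pushforward_ideal`). The two END read-outs it needs are proved here:

* `monomialSum_eq_top_of_wonM_one` — a marking-one WIN (`PolyhedraGame.WonM 1 s`: at every game stratum some member has weight
  `0`) attached to a scheme datum by `GameInv` means the sum of monomial ideals is the UNIT ideal sheaf (at a point `x`, the
  positions through `x` form a stratum — `GameInv.image_lab_mem_str`; the winning vector reads as the weight at `x` of some
  member — `GameInv.exists_member_weightAt_eq`; conclude by `monomialSum_eq_top_of_forall_exists_weightAt_eq_zero`).
* `eq_top_of_le_of_comap_subschemeι_eq_top` — if `H ≤ K` and `K|_{V(H)} = ⊤` then `K = ⊤` (`cosupp K ⊆ V(H)` carries no point of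
  `cosupp (K|_{V(H)}) = ∅`): the step «`J_fin = ⊤` on the final carrier ⇒ `K_fin = ⊤`» of (D2).

## References (for the mathematics; nothing here is a statement of the manuscript under review)
* J. Kollár, *Lectures on Resolution of Singularities* (2007), (3.111) Step 3; 3.30.3. [Kollar2007]
-/

-- `Summit.<Summit>.<Sub>.Theorems` with `Sub = Summit` (single-conjunct summit, D-0017)
set_option linter.dupNamespace false

noncomputable section

open CategoryTheory AlgebraicGeometry TopologicalSpace IsLocalRing
open Literature.AlgebraicGeometry.Resolution

namespace Summit.ResolutionOfSingularities.ResolutionOfSingularities.Theorems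

namespace MonomialCleanup

open DepthTargets (monomialSum)
open PolyhedraGame (State WonM weight wonM_one_iff)

universe u

variable {X : Scheme.{u}}

open Classical in
/-- **A marking-one win is the unit ideal.** [cite: Kollar2007, (3.111) Step 3] -/
theorem monomialSum_eq_top_of_wonM_one {s : State} {Es : List X.IdealSheafData}
    {𝒦 : List (List (X.IdealSheafData × ℕ))} {lab : ℕ → ℕ} (hinv : GameInv s Es 𝒦 lab) (hwon : WonM 1 s) :
    monomialSum 𝒦 = ⊤ := by
  refine monomialSum_eq_top_of_forall_exists_weightAt_eq_zero fun x => ?_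
  -- the clique of `x` and its stratum
  set S : Finset ℕ := (Finset.range Es.length).filter fun k => x ∈ (nthSheaf Es k).support with hS
  have hSiff : ∀ k, k ∈ S ↔ k < Es.length ∧ x ∈ (nthSheaf Es k).support := fun k => by
    rw [hS, Finset.mem_filter, Finset.mem_range]
  have hstr : S.image lab ∈ s.Str := hinv.image_lab_mem_str fun k hk => (hSiff k).mp hk
  obtain ⟨α, hα, h0⟩ := hwon _ hstr
  obtain ⟨A, hA, hw⟩ := hinv.exists_member_weightAt_eq hα hSiff
  exact ⟨A, hA, by rw [hw]; exact Nat.lt_one_iff.mp h0⟩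

/-- **An ideal that contains a closed subscheme's ideal and is trivial on it is trivial**: `H ≤ K` and `K|_{V(H)} = ⊤` give
`K = ⊤`. [folklore] -/
theorem eq_top_of_le_of_comap_subschemeι_eq_top {K H : X.IdealSheafData} (hHK : H ≤ K)
    (h : K.comap H.subschemeι = ⊤) : K = ⊤ := by
  rw [← Scheme.IdealSheafData.support_eq_bot_iff, ← le_bot_iff]
  intro x hx
  have hxH : x ∈ (H.support : Set X) := Scheme.IdealSheafData.support_antitone hHK hx
  rw [← Scheme.IdealSheafData.range_subschemeι] at hxH
  obtain ⟨y, rfl⟩ := hxH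
  have hy : y ∈ ((K.comap H.subschemeι).support : Set _) := by
    rw [Scheme.IdealSheafData.support_comap]
    exact hx
  rw [h, Scheme.IdealSheafData.support_top] at hy
  exact hy

end MonomialCleanup

end Summit.ResolutionOfSingularities.ResolutionOfSingularities.Theorems

end
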